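import Summits.BirchSwinnertonDyer.BirchSwinnertonDyer.Theorems.ResidualThetaTransportAtTwoLambdaLeCardQuotient
import Mathlib.RingTheory.DiscreteValuationRing.Basic
import Mathlib.RingTheory.PowerSeries.Order
import Mathlib.RingTheory.LocalRing.ResidueField.Defs
import HarnessLib

/-!
# Sketch (crux-ideate #2, round 1, gen 5) — typed statements for the GL₂/ℚ_∞-currency line «θ-transport»
# on (R≥)ᵖ `ResidualThetaCountLowerPureAtTwo` (stmt-BirchSwinnertonDyer-26074) and the next checkable
# statements of cards `kato-defect-transport-at-two` (K1) and `character-side-signed-transport` (K2).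

Statements only (`def … : Prop`), over EXISTING declarations; nothing here is proved, registered or filed as an item;
no summit statement is proved by this seat. See memo `THETA-LINE-ideator2-r1g5.md` (same crux folder) for the roles:

* `LatticeHomothety` (θ1) — the elementary half of the local-type stub S2θ («`T_g|G_ℚ₂ ≅ T₂W ⊗ 𝒪_λ`»): two commensurable
  `G`-stable lattices over a DVR, one of them residually irreducible, are homothetic. K2's next checkable statement.
* `ResidualBaseChangeCard` (θ2) — `#(k ⊗_{𝔽₂} V) = (#V)^{dim k}`: the count half of «S3 is formal» (`T_g/2T_g ≅ W[2]^{⊕[𝒪_λ:ℤ₂]}`).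
* `FinrankRestrictScalars` (θ3) — `rank_{ℤ₂} M = [𝒪:ℤ₂] · rank_𝒪 M`: with THEOREM p613549
  (`LambdaLowerBound.two_pow_lambdaInvariant_le_natCard_quotient`) it replaces the «𝒪-version of p613549» (S4) by restriction of scalars.
* `LambdaCyclicEqResidualOrder` (K1·L5) — `λ(Λ/(f)) = ord_T(f mod 2)` when `f ∉ 2Λ`: the `H¹/Λz`-half of «Kato's defect δ is residual»
  (card K1, [KLP2a]); Weierstrass-preparation grade.
-/

set_option autoImplicit false
-- Cruxes namespace repeats the summit name by design (D-0017 nested layout)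
set_option linter.dupNamespace false

noncomputable section

open scoped TensorProduct Pointwise

open Literature.NumberTheory.EllipticCurves

namespace Summit.BirchSwinnertonDyer.BirchSwinnertonDyer.Cruxes.ResidualThetaCountLowerPureAtTwo.ThetaTransport

/-- (θ1) **Lattice homothety.** Over a discrete valuation ring `O`, inside a torsion-free `O`-module `V` with an `O`-linear action
of a monoid `G`: if `T, T'` are finitely generated `G`-stable submodules, commensurable (`a•T' ≤ T`, `b•T ≤ T'` for nonzero `a, b`),
and `T` is RESIDUALLY IRREDUCIBLE (the only `G`-stable submodules between `𝔪T` and `T` are `𝔪T` and `T`), then `T' = c•T` or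
`T = c•T'` for some nonzero `c`. (Scale `T'` into `T` but not into `𝔪T`; `T' + 𝔪T` is `G`-stable hence `= T`; Nakayama.)
This is the algebra making the local isomorphism `θ : T_g|G_ℚ₂ ≅ T₂W ⊗ 𝒪_λ` unique up to `𝒪_λˣ` once it exists rationally. -/
def LatticeHomothety : Prop :=
  ∀ (O : Type) [CommRing O] [IsDomain O] [IsDiscreteValuationRing O]
    (V : Type) [AddCommGroup V] [Module O V] [NoZeroSMulDivisors O V]
    (G : Type) [Monoid G] [DistribMulAction G V] [SMulCommClass G O V]
    (T T' : Submodule O V),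
    T.FG → T'.FG → T ≠ ⊥ →
    (∀ g : G, ∀ x ∈ T, g • x ∈ T) → (∀ g : G, ∀ x ∈ T', g • x ∈ T') →
    (∃ a : O, a ≠ 0 ∧ a • T' ≤ T) → (∃ b : O, b ≠ 0 ∧ b • T ≤ T') →
    (∀ N : Submodule O V, IsLocalRing.maximalIdeal O • T ≤ N → N ≤ T →
        (∀ g : G, ∀ x ∈ N, g • x ∈ N) → N = IsLocalRing.maximalIdeal O • T ∨ N = T) →
    ∃ c : O, c ≠ 0 ∧ (c • T = T' ∨ c • T' = T)

/-- (θ2) **Residual base change count.** For a finite `𝔽₂`-vector space `V` and a finite free `𝔽₂`-algebra (or just module) `k` of rank `n`,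
`#(k ⊗_{𝔽₂} V) = (#V)^n`. With `T_g/2T_g ≅ W[2] ⊗_{𝔽₂} 𝒪_λ/2` as `𝔽₂[G_ℚ]`-modules this turns the crux's W-side residual count into the
g-side one FORMALLY (local conditions are `𝒪_λ`-linear, hence decompose). [folklore] -/
def ResidualBaseChangeCard : Prop :=
  ∀ (k : Type) [AddCommGroup k] [Module (ZMod 2) k] [Module.Finite (ZMod 2) k]
    (V : Type) [AddCommGroup V] [Module (ZMod 2) V] [Finite V],
    Nat.card (k ⊗[ZMod 2] V) = Nat.card V ^ Module.finrank (ZMod 2) k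

/-- (θ3) **Rank under restriction of scalars.** For `𝒪` a domain, module-finite and free of rank `n` over `ℤ₂`, and `M` a finitely generated
`𝒪`-module: `dim_{ℚ₂}(ℚ₂ ⊗_{ℤ₂} M) = n · dim_{Frac 𝒪}(Frac 𝒪 ⊗_𝒪 M)`. Consequence: the tree's `lambdaInvariant 2` of a `Λ_𝒪`-module viewed
as a `Λ = ℤ₂⟦T⟧`-module is `[𝒪:ℤ₂] · λ_𝒪`, so THEOREM p613549 (`2^λ ≤ #(M/2M)`, no torsion-freeness) already serves the `𝒪`-side (S4). [folklore] -/
def FinrankRestrictScalars : Prop :=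
  ∀ (O : Type) [CommRing O] [IsDomain O] [Algebra ℤ_[2] O] [Module.Finite ℤ_[2] O] [Module.Free ℤ_[2] O]
    (M : Type) [AddCommGroup M] [Module O M] [Module.Finite O M],
    Module.finrank ℚ_[2] (ℚ_[2] ⊗[ℤ_[2]] (RestrictScalars ℤ_[2] O M)) =
      Module.finrank ℤ_[2] O * Module.finrank (FractionRing O) (FractionRing O ⊗[O] M)

/-- (K1·L5) **`λ` of a cyclic `Λ`-module is the residual `T`-order.** For `f ∈ Λ = ℤ₂⟦T⟧` with nonzero reduction `f̄ ∈ 𝔽₂⟦T⟧`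
(`μ(f) = 0`), `λ(Λ/(f)) = ord_T(f̄)` (Weierstrass preparation: `Λ/(f)` is free over `ℤ₂` of rank the Weierstrass degree, which is
`ord_T f̄`). In card K1 this is the `H¹_Iw(T)/Λz ≅ Λ/(f_z)`-half of «Kato's defect `δ` is read off residually» ([KLP2a]):
the residual zeta class `z̄ = f̄_z · b̄` determines `λ(H¹/Λz)`. [cite: Washington1997, §7.1 Thm 7.3 (Weierstrass preparation); §13.2] -/
def LambdaCyclicEqResidualOrder : Prop :=
  ∀ f : IwasawaAlgebra 2,
    PowerSeries.map (IsLocalRing.residue ℤ_[2]) f ≠ 0 →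
      lambdaInvariant 2 (IwasawaAlgebra 2 ⧸ Ideal.span {f}) =
        (PowerSeries.map (IsLocalRing.residue ℤ_[2]) f).order.toNat

end Summit.BirchSwinnertonDyer.BirchSwinnertonDyer.Cruxes.ResidualThetaCountLowerPureAtTwo.ThetaTransport

end
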